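import Literature.Computability.Cryptography.WordRAMToTM2Table
import Literature.Computability.Cryptography.KCNFToWordRAMInput
import Literature.Computability.Complexity.TM2PassThrough
import HarnessLib

/-!
# Word-RAM oracle programs on multi-stack machines, V: the exact word size and the table counter

Family `fine-grained`, continuing `WordRAMToTM2Table.lean` (register universe `RQ`). A word-RAM program is not monotone in
its word size (arithmetic wraps modulo `2^W`), and the program of a fine-grained reduction is only
specified at the word size `k · inputWidth x` of `FGProblem.InTimeInst` / `FGReducible`; the
simulating machine must therefore compute this word size *exactly* from its memory image before
interpreting. From the log of the memory image `|x| :: x` (the front end of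
`KCNFToWordRAMInput.lean` builds a permutation of `segLog 0 (|x| :: x)`) this is one scan: the
longest value item has `max (size |x|) (max_i size xᵢ)` bits, and
`inputWidth x = size (max |x| (foldr max 1 x)) = max 1 (that)` (`max_one_maxValLen_eq_inputWidth`).

* `maxValLen E` — the longest value numeral of a log; its characterisation by membership, hence
  invariance under permutations;
* `scanBodyR` / `scanLoopR` / `rulerScan k` — one pass over the log code (two-bits-per-bit item
  code of `encLog`: tag `true, b` for a payload bit, terminator `false, s` with `s = true` for value
  items), keeping the current item length on `s3` and the maximum over value items on `lc` in unary
  (`Com.subFrom`, `Com.addReg` compute `max`), restoring the log, then `wr := 1^{k · max 1 m}`;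
  `runs_rulerScan`;
* `boundU c` / `runs_boundU` — the master counter of the table rebuild, `un := 1^{2^W + c}`, from the
  ruler `1^W` by `W` doublings (`Com.dblReg`).

## References

* S. A. Cook, R. A. Reckhow, *Time bounded random access machines*, JCSS 7 (1973) 354–375, §2.
* V. Vassilevska Williams, Proc. ICM 2018, §2 (the `Θ(log n)`-bit word convention).
-/

namespace Literature.Computability.Cryptography.WordRAM.ToTM2

open _root_.Computability Complexity Complexity.Com

/-! ### The longest value numeral of a log -/

/-- The length of the longest value numeral of a log (`0` for the empty log). [folklore] -/
def maxValLen : List (List Bool × List Bool) → ℕ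
  | [] => 0
  | e :: E => max e.2.length (maxValLen E)

/-- Every value numeral is at most the longest one. [folklore] -/
theorem length_le_maxValLen {E : List (List Bool × List Bool)} {e : List Bool × List Bool} (h : e ∈ E) :
    e.2.length ≤ maxValLen E := by
  induction E with
  | nil => simp at h
  | cons f E ih =>
    rw [maxValLen]
    rcases List.mem_cons.1 h with rfl | h
    · exact le_max_left _ _
    · exact le_trans (ih h) (le_max_right _ _)

/-- The longest value numeral is attained, or the log is empty. [folklore] -/
theorem maxValLen_eq_zero_or_mem (E : List (List Bool × List Bool)) :
    maxValLen E = 0 ∨ ∃ e ∈ E, e.2.length = maxValLen E := by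
  induction E with
  | nil => exact Or.inl rfl
  | cons f E ih =>
    rw [maxValLen]
    rcases le_total (maxValLen E) f.2.length with h | h
    · exact Or.inr ⟨f, by simp, (max_eq_left h).symm⟩
    · rw [max_eq_right h]
      rcases ih with h0 | ⟨e, he, hl⟩
      · rcases Nat.eq_zero_or_pos f.2.length with hf | hf
        · exact Or.inr ⟨f, by simp, by omega⟩
        · omega
      · exact Or.inr ⟨e, by simp [he], hl⟩

/-- `maxValLen` is invariant under permutations. [folklore] -/
theorem maxValLen_eq_of_perm {E E' : List (List Bool × List Bool)} (h : E.Perm E') : maxValLen E = maxValLen E' := by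
  apply le_antisymm
  · rcases maxValLen_eq_zero_or_mem E with h0 | ⟨e, he, hl⟩
    · rw [h0]; exact Nat.zero_le _
    · rw [← hl]; exact length_le_maxValLen (h.subset he)
  · rcases maxValLen_eq_zero_or_mem E' with h0 | ⟨e, he, hl⟩
    · rw [h0]; exact Nat.zero_le _
    · rw [← hl]; exact length_le_maxValLen (h.symm.subset he)

/-- `Nat.size` commutes with `max`. [folklore] -/
theorem size_max (p q : ℕ) : (max p q).size = max p.size q.size := by
  rcases le_total p q with h | h
  · rw [max_eq_right h, max_eq_right (Nat.size_le_size h)]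
  · rw [max_eq_left h, max_eq_left (Nat.size_le_size h)]

/-- The longest value numeral of a segment log is the size of the largest word. [folklore] -/
theorem maxValLen_segLog : ∀ (A : ℕ) (ws : List ℕ), maxValLen (KCNFToRAM.segLog A ws) = (ws.foldr max 0).size
  | _, [] => by simp [maxValLen]
  | A, v :: ws => by
    rw [KCNFToRAM.segLog_cons, maxValLen, maxValLen_segLog (A + 1) ws, List.foldr_cons, TM2Pass.length_encodeNat_eq_size, size_max]

/-- **The word size from the log of the memory image.** For a permutation `E` of the segment log of
`|x| :: x`, `max 1 (maxValLen E) = inputWidth x`. [folklore] -/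
theorem max_one_maxValLen_eq_inputWidth {E : List (List Bool × List Bool)} (x : List ℕ)
    (h : E.Perm (KCNFToRAM.segLog 0 (x.length :: x))) : max 1 (maxValLen E) = inputWidth x := by
  rw [maxValLen_eq_of_perm h, maxValLen_segLog, List.foldr_cons, inputWidth, size_max, size_max]
  have key : ∀ l : List ℕ, max 1 (l.foldr max 0).size = (l.foldr max 1).size := by
    intro l
    induction l with
    | nil => decide
    | cons a l ih => rw [List.foldr_cons, List.foldr_cons, size_max, size_max, ← ih]; omega
  rw [← key]
  omega

/-! ### The scan -/

/-- Rewriting the initial registers of a run. [folklore] -/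
theorem _root_.Literature.Computability.Complexity.Com.Runs.start_eq {ι : Type} [DecidableEq ι] {c : Com ι}
    {R R₁ R' : Regs ι} {B : ℕ} (h : Runs c R R' B) (e : R = R₁) : Runs c R₁ R' B := e ▸ h

/-- The end of a value item: `lc := max lc s3` in unary (copy `lc`, subtract it from `s3`, add the
rest of `s3` to `lc`), then clear `s3`. [folklore] -/
def valueEnd : Com RQ :=
  ((copy (rX .lc) (rX .c2) (rX .s1) (rX .s2) ;; subFrom (rX .s3) (rX .c2)) ;; addReg (rX .s3) (rX .lc) (rX .c2)) ;; clear (rX .s3)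

/-- **Effect of `valueEnd`**: `lc := 1^{max B c}`, `s3 := []`. [folklore] -/
theorem runs_valueEnd (ρ : St) (F : Regs AReg) (T : XS) (hs1 : T.s1 = []) (hs2 : T.s2 = []) (B c : ℕ) :
    Runs valueEnd (stateQ ρ F { T with lc := ones B, s3 := ones c, c2 := [] })
      (stateQ ρ F { T with lc := ones (max B c), s3 := [], c2 := [] }) (14 * B + 9 * c + 7) := by
  unfold valueEnd
  have h1 := runs_copy (a := rX .lc) (b := rX .c2) (t := rX .s1) (u := rX .s2) (by simp) (by simp) (by simp) (by simp) (by simp)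
    (by simp) (stateQ ρ F { T with lc := ones B, s3 := ones c, c2 := [] }) (by simp [hs1]) (by simp [hs2])
  simp only [stateQ_rX, XS.regs_lc, XS.regs_c2, List.append_nil, update_stateQ_rX, XS.update_regs_c2] at h1
  have h2 := h1.seq (runs_subFrom (x := rX .s3) (y := rX .c2) (by simp) (ones B) _ (by simp))
  simp only [stateQ_rX, XS.regs_s3, update_stateQ_rX, XS.update_regs_c2, XS.update_regs_s3, drop_ones, List.length_replicate] at h2
  have h3 := h2.seq (runs_addReg (p := rX .s3) (v := rX .lc) (t := rX .c2) (by simp) (by simp) (by simp) _ (by simp))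
  simp only [stateQ_rX, XS.regs_s3, XS.regs_lc, List.length_replicate, ones_append, update_stateQ_rX, XS.update_regs_s3,
    XS.update_regs_lc] at h3
  have h4 := h3.seq (runs_clear (rX .s3) _)
  simp only [stateQ_rX, XS.regs_s3, List.length_replicate, update_stateQ_rX, XS.update_regs_s3] at h4
  refine h4.of_eq ?_ ?_
  · rw [show c - B + B = max B c by omega]
  · simp only [ones] at *
    omega

/-- The loop body on the popped bit `b`: save it on `mem2`; if a tag `true` was pending (`w1`) it is
a payload bit (`s3` gains one); if a tag `false` was pending (`w2`) it is the sign bit (value item: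
`valueEnd`; key item: clear `s3`); otherwise it is a tag (record it on `w1`/`w2`). [folklore] -/
def scanBodyR (b : Bool) : Com RQ :=
  push (rK .mem2) b ;;
  pop (rX .w1) (push (rX .s3) true) (push (rX .s3) true)
    (pop (rX .w2) (bif b then valueEnd else clear (rX .s3)) (bif b then valueEnd else clear (rX .s3))
      (bif b then push (rX .w1) true else push (rX .w2) true))

/-- The scan loop over the log code. [folklore] -/
def scanLoopR : Com RQ := loop (rK .mem) (scanBodyR true) (scanBodyR false)

/-- The interpreter file during the scan: log suffix on `mem`, saved bits on `mem2` (reducible, so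
that it is a structure literal over `ρ` for `simp`). [folklore] -/
abbrev scSt (ρ : St) (mem mem2 : List Bool) : St := { ρ with mem := mem, mem2 := mem2 }

/-- A tag bit `true` in the tag phase: saved, recorded on `w1`. [folklore] -/
theorem runs_scanBodyR_tagT (ρ : St) (F : Regs AReg) (T : XS) (mem m2 s3 lc : List Bool) :
    Runs (scanBodyR true) (stateQ (scSt ρ mem m2) F { T with w1 := [], w2 := [], s3 := s3, lc := lc, c2 := [] })
      (stateQ (scSt ρ mem (true :: m2)) F { T with w1 := [true], w2 := [], s3 := s3, lc := lc, c2 := [] }) 6 := by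
  unfold scanBodyR
  have p1 : Runs (push (rK .mem2) true) (stateQ (scSt ρ mem m2) F { T with w1 := [], w2 := [], s3 := s3, lc := lc, c2 := [] })
      (stateQ (scSt ρ mem (true :: m2)) F { T with w1 := [], w2 := [], s3 := s3, lc := lc, c2 := [] }) 1 := Runs.push' (by simp)
  have p2 : Runs (push (rX .w1) true) (stateQ (scSt ρ mem (true :: m2)) F { T with w1 := [], w2 := [], s3 := s3, lc := lc, c2 := [] })
      (stateQ (scSt ρ mem (true :: m2)) F { T with w1 := [true], w2 := [], s3 := s3, lc := lc, c2 := [] }) 1 := Runs.push' (by simp)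
  exact (p1.seq (Runs.pop_nil _ _ (by simp) (Runs.pop_nil _ _ (by simp) p2))).of_eq rfl (by omega)

/-- A tag bit `false` in the tag phase: saved, recorded on `w2`. [folklore] -/
theorem runs_scanBodyR_tagF (ρ : St) (F : Regs AReg) (T : XS) (mem m2 s3 lc : List Bool) :
    Runs (scanBodyR false) (stateQ (scSt ρ mem m2) F { T with w1 := [], w2 := [], s3 := s3, lc := lc, c2 := [] })
      (stateQ (scSt ρ mem (false :: m2)) F { T with w1 := [], w2 := [true], s3 := s3, lc := lc, c2 := [] }) 6 := by
  unfold scanBodyR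
  have p1 : Runs (push (rK .mem2) false) (stateQ (scSt ρ mem m2) F { T with w1 := [], w2 := [], s3 := s3, lc := lc, c2 := [] })
      (stateQ (scSt ρ mem (false :: m2)) F { T with w1 := [], w2 := [], s3 := s3, lc := lc, c2 := [] }) 1 := Runs.push' (by simp)
  have p2 : Runs (push (rX .w2) true) (stateQ (scSt ρ mem (false :: m2)) F { T with w1 := [], w2 := [], s3 := s3, lc := lc, c2 := [] })
      (stateQ (scSt ρ mem (false :: m2)) F { T with w1 := [], w2 := [true], s3 := s3, lc := lc, c2 := [] }) 1 := Runs.push' (by simp)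
  exact (p1.seq (Runs.pop_nil _ _ (by simp) (Runs.pop_nil _ _ (by simp) p2))).of_eq rfl (by omega)

/-- A payload bit (tag `true` pending): saved, `s3` gains one. [folklore] -/
theorem runs_scanBodyR_data (ρ : St) (F : Regs AReg) (T : XS) (b : Bool) (mem m2 lc : List Bool) (c : ℕ) :
    Runs (scanBodyR b) (stateQ (scSt ρ mem m2) F { T with w1 := [true], w2 := [], s3 := ones c, lc := lc, c2 := [] })
      (stateQ (scSt ρ mem (b :: m2)) F { T with w1 := [], w2 := [], s3 := ones (c + 1), lc := lc, c2 := [] }) 4 := by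
  unfold scanBodyR
  have p1 : Runs (push (rK .mem2) b) (stateQ (scSt ρ mem m2) F { T with w1 := [true], w2 := [], s3 := ones c, lc := lc, c2 := [] })
      (stateQ (scSt ρ mem (b :: m2)) F { T with w1 := [true], w2 := [], s3 := ones c, lc := lc, c2 := [] }) 1 := Runs.push' (by simp)
  have hk : stateQ (scSt ρ mem (b :: m2)) F { T with w1 := [true], w2 := [], s3 := ones c, lc := lc, c2 := [] } (rX .w1) = true :: [] := by
    simp
  have hupd : Function.update (stateQ (scSt ρ mem (b :: m2)) F { T with w1 := [true], w2 := [], s3 := ones c, lc := lc, c2 := [] })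
      (rX .w1) [] = stateQ (scSt ρ mem (b :: m2)) F { T with w1 := [], w2 := [], s3 := ones c, lc := lc, c2 := [] } := by simp
  have p2 : Runs (push (rX .s3) true) (stateQ (scSt ρ mem (b :: m2)) F { T with w1 := [], w2 := [], s3 := ones c, lc := lc, c2 := [] })
      (stateQ (scSt ρ mem (b :: m2)) F { T with w1 := [], w2 := [], s3 := ones (c + 1), lc := lc, c2 := [] }) 1 :=
    Runs.push' (by simp [ones_succ])
  exact (p1.seq (Runs.pop_true' _ _ hk hupd p2)).of_eq rfl (by omega)

/-- The maximum after an item with sign `s`: a value item updates it, a key item does not. [folklore] -/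
def itemMax (B c : ℕ) (s : Bool) : ℕ := bif s then max B c else B

/-- The sign bit (tag `false` pending): saved; a value item updates the maximum, a key item does
not; `s3` is cleared. [folklore] -/
theorem runs_scanBodyR_sign (ρ : St) (F : Regs AReg) (T : XS) (hs1 : T.s1 = []) (hs2 : T.s2 = []) (s : Bool)
    (mem m2 : List Bool) (B c : ℕ) :
    Runs (scanBodyR s) (stateQ (scSt ρ mem m2) F { T with w1 := [], w2 := [true], s3 := ones c, lc := ones B, c2 := [] })
      (stateQ (scSt ρ mem (s :: m2)) F { T with w1 := [], w2 := [], s3 := [], lc := ones (itemMax B c s), c2 := [] })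
      (14 * B + 9 * c + 12) := by
  unfold scanBodyR
  have p1 : Runs (push (rK .mem2) s) (stateQ (scSt ρ mem m2) F { T with w1 := [], w2 := [true], s3 := ones c, lc := ones B, c2 := [] })
      (stateQ (scSt ρ mem (s :: m2)) F { T with w1 := [], w2 := [true], s3 := ones c, lc := ones B, c2 := [] }) 1 := Runs.push' (by simp)
  have hk : stateQ (scSt ρ mem (s :: m2)) F { T with w1 := [], w2 := [true], s3 := ones c, lc := ones B, c2 := [] } (rX .w2) = true :: [] := by
    simp
  have hupd : Function.update (stateQ (scSt ρ mem (s :: m2)) F { T with w1 := [], w2 := [true], s3 := ones c, lc := ones B, c2 := [] })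
      (rX .w2) [] = stateQ (scSt ρ mem (s :: m2)) F { T with w1 := [], w2 := [], s3 := ones c, lc := ones B, c2 := [] } := by simp
  have p2 : Runs (bif s then valueEnd else clear (rX .s3))
      (stateQ (scSt ρ mem (s :: m2)) F { T with w1 := [], w2 := [], s3 := ones c, lc := ones B, c2 := [] })
      (stateQ (scSt ρ mem (s :: m2)) F { T with w1 := [], w2 := [], s3 := [], lc := ones (itemMax B c s), c2 := [] })
      (14 * B + 9 * c + 7) := by
    cases s with
    | true =>
      have := runs_valueEnd (scSt ρ mem (true :: m2)) F { T with w1 := [], w2 := [] } hs1 hs2 B c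
      simpa [itemMax] using this
    | false =>
      have := runs_clear (rX .s3) (stateQ (scSt ρ mem (false :: m2)) F { T with w1 := [], w2 := [], s3 := ones c, lc := ones B, c2 := [] })
      simp only [stateQ_rX, XS.regs_s3, List.length_replicate, update_stateQ_rX, XS.update_regs_s3] at this
      refine this.of_eq ?_ (by omega)
      simp [itemMax]
  exact (p1.seq (Runs.pop_nil _ _ (by simp) (Runs.pop_true' _ _ hk hupd p2))).of_eq rfl (by omega)

/-- **A payload word, continuation form.** From the tag phase in front of `tagged w ++ rest`, given
the run of the loop from behind the word (saved bits prepended, `s3` longer by `|w|`), the loop runs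
from in front of it, `14` steps per payload bit. [folklore] -/
theorem scanR_tagged_cont (ρ : St) (F : Regs AReg) (T : XS) : ∀ (w : List Bool) (rest m2 : List Bool) (c : ℕ) (lc : List Bool)
    {R' : Regs RQ} {B' : ℕ},
    Runs scanLoopR (stateQ (scSt ρ rest ((tagged w).reverse ++ m2)) F { T with w1 := [], w2 := [], s3 := ones (c + w.length), lc := lc, c2 := [] })
      R' B' →
    Runs scanLoopR (stateQ (scSt ρ (tagged w ++ rest) m2) F { T with w1 := [], w2 := [], s3 := ones c, lc := lc, c2 := [] }) R'
      (B' + 14 * w.length)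
  | [], rest, m2, c, lc, R', B', h => by simpa using h
  | b :: w, rest, m2, c, lc, R', B', h => by
    have e : stateQ (scSt ρ rest ((tagged (b :: w)).reverse ++ m2)) F { T with w1 := [], w2 := [], s3 := ones (c + (b :: w).length), lc := lc, c2 := [] } =
        stateQ (scSt ρ rest ((tagged w).reverse ++ (b :: true :: m2))) F { T with w1 := [], w2 := [], s3 := ones (c + 1 + w.length), lc := lc, c2 := [] } := by
      simp [tagged, List.append_assoc, show c + (w.length + 1) = c + 1 + w.length by omega]
    have ih := scanR_tagged_cont ρ F T w rest (b :: true :: m2) (c + 1) lc (h.start_eq e)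
    have hk2 : stateQ (scSt ρ (b :: (tagged w ++ rest)) (true :: m2)) F { T with w1 := [true], w2 := [], s3 := ones c, lc := lc, c2 := [] } (rK .mem) =
        b :: (tagged w ++ rest) := by simp
    have hupd2 : Function.update (stateQ (scSt ρ (b :: (tagged w ++ rest)) (true :: m2)) F { T with w1 := [true], w2 := [], s3 := ones c, lc := lc, c2 := [] })
        (rK .mem) (tagged w ++ rest) = stateQ (scSt ρ (tagged w ++ rest) (true :: m2)) F { T with w1 := [true], w2 := [], s3 := ones c, lc := lc, c2 := [] } := by
      simp
    have step2 : Runs scanLoopR (stateQ (scSt ρ (b :: (tagged w ++ rest)) (true :: m2)) F { T with w1 := [true], w2 := [], s3 := ones c, lc := lc, c2 := [] })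
        R' (4 + 2 + (B' + 14 * w.length)) := by
      cases b
      · exact Runs.loop_false' hk2 hupd2 (runs_scanBodyR_data ρ F T false _ _ lc c) ih
      · exact Runs.loop_true' hk2 hupd2 (runs_scanBodyR_data ρ F T true _ _ lc c) ih
    have hk1 : stateQ (scSt ρ (tagged (b :: w) ++ rest) m2) F { T with w1 := [], w2 := [], s3 := ones c, lc := lc, c2 := [] } (rK .mem) =
        true :: (b :: (tagged w ++ rest)) := by simp [tagged]
    have hupd1 : Function.update (stateQ (scSt ρ (tagged (b :: w) ++ rest) m2) F { T with w1 := [], w2 := [], s3 := ones c, lc := lc, c2 := [] })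
        (rK .mem) (b :: (tagged w ++ rest)) = stateQ (scSt ρ (b :: (tagged w ++ rest)) m2) F { T with w1 := [], w2 := [], s3 := ones c, lc := lc, c2 := [] } := by
      simp
    refine (Runs.loop_true' hk1 hupd1 (runs_scanBodyR_tagT ρ F T _ m2 (ones c) lc) step2).of_eq rfl ?_
    simp only [List.length_cons]; omega

/-- **An item, continuation form**: payload `w`, then the terminator `false, s`; `s3` ends empty and
`lc` holds the updated maximum. [folklore] -/
theorem scanR_item_cont (ρ : St) (F : Regs AReg) (T : XS) (hs1 : T.s1 = []) (hs2 : T.s2 = [])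
    (w rest m2 : List Bool) (s : Bool) (B : ℕ) {R' : Regs RQ} {B' : ℕ}
    (h : Runs scanLoopR (stateQ (scSt ρ rest (s :: false :: ((tagged w).reverse ++ m2))) F
      { T with w1 := [], w2 := [], s3 := [], lc := ones (itemMax B w.length s), c2 := [] }) R' B') :
    Runs scanLoopR (stateQ (scSt ρ (tagged w ++ false :: s :: rest) m2) F { T with w1 := [], w2 := [], s3 := [], lc := ones B, c2 := [] }) R'
      (B' + 14 * B + 9 * w.length + 22 + 14 * w.length) := by
  -- the sign bit, then the rest
  have hk2 : stateQ (scSt ρ (s :: rest) (false :: ((tagged w).reverse ++ m2))) F { T with w1 := [], w2 := [true], s3 := ones w.length, lc := ones B, c2 := [] } (rK .mem) =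
      s :: rest := by simp
  have hupd2 : Function.update (stateQ (scSt ρ (s :: rest) (false :: ((tagged w).reverse ++ m2))) F { T with w1 := [], w2 := [true], s3 := ones w.length, lc := ones B, c2 := [] })
      (rK .mem) rest = stateQ (scSt ρ rest (false :: ((tagged w).reverse ++ m2))) F { T with w1 := [], w2 := [true], s3 := ones w.length, lc := ones B, c2 := [] } := by
    simp
  have step2 : Runs scanLoopR (stateQ (scSt ρ (s :: rest) (false :: ((tagged w).reverse ++ m2))) F { T with w1 := [], w2 := [true], s3 := ones w.length, lc := ones B, c2 := [] })
      R' ((14 * B + 9 * w.length + 12) + 2 + B') := by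
    cases s
    · exact Runs.loop_false' hk2 hupd2 (runs_scanBodyR_sign ρ F T hs1 hs2 false _ _ B w.length) h
    · exact Runs.loop_true' hk2 hupd2 (runs_scanBodyR_sign ρ F T hs1 hs2 true _ _ B w.length) h
  -- the tag `false`
  have hk1 : stateQ (scSt ρ (false :: s :: rest) ((tagged w).reverse ++ m2)) F { T with w1 := [], w2 := [], s3 := ones w.length, lc := ones B, c2 := [] } (rK .mem) =
      false :: s :: rest := by simp
  have hupd1 : Function.update (stateQ (scSt ρ (false :: s :: rest) ((tagged w).reverse ++ m2)) F { T with w1 := [], w2 := [], s3 := ones w.length, lc := ones B, c2 := [] })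
      (rK .mem) (s :: rest) = stateQ (scSt ρ (s :: rest) ((tagged w).reverse ++ m2)) F { T with w1 := [], w2 := [], s3 := ones w.length, lc := ones B, c2 := [] } := by
    simp
  have step1 : Runs scanLoopR (stateQ (scSt ρ (false :: s :: rest) ((tagged w).reverse ++ m2)) F { T with w1 := [], w2 := [], s3 := ones w.length, lc := ones B, c2 := [] })
      R' (6 + 2 + ((14 * B + 9 * w.length + 12) + 2 + B')) := Runs.loop_false' hk1 hupd1 (runs_scanBodyR_tagF ρ F T _ _ (ones w.length) (ones B)) step2
  -- the payload
  have := scanR_tagged_cont ρ F T w (false :: s :: rest) m2 0 (ones B) (by simpa using step1)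
  simpa [show 6 + 2 + (14 * B + 9 * w.length + 12 + 2 + B') + 14 * w.length = B' + 14 * B + 9 * w.length + 22 + 14 * w.length by omega]
    using this

/-- The maximum over a log, starting from `B`. [folklore] -/
def logMax (B : ℕ) (E : List (List Bool × List Bool)) : ℕ := max B (maxValLen E)

/-- The cost of scanning `n` entries with numerals and running maximum of at most `β` digits. [folklore] -/
def scanCost (β n : ℕ) : ℕ := n * (2 * (37 * β + 22)) + 1

/-- **The whole log.** From the tag phase in front of `encLog E` with maximum `B ≤ β`, the loop
consumes the (`β`-bounded) log, saving it reversed on `mem2`, and ends with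
`lc = 1^{max B (maxValLen E)}`, within `scanCost β |E|`. [folklore] -/
theorem scanR_log : ∀ (E : List (List Bool × List Bool)) (ρ : St) (F : Regs AReg) (T : XS), T.s1 = [] → T.s2 = [] →
    ∀ (m2 : List Bool) (B β : ℕ), BoundedLog β E → B ≤ β →
    Runs scanLoopR (stateQ (scSt ρ (encLog E) m2) F { T with w1 := [], w2 := [], s3 := [], lc := ones B, c2 := [] })
      (stateQ (scSt ρ [] ((encLog E).reverse ++ m2)) F { T with w1 := [], w2 := [], s3 := [], lc := ones (logMax B E), c2 := [] })
      (scanCost β E.length)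
  | [], ρ, F, T, _, _, m2, B, β, _, _ => by
    refine (Runs.loop_nil _ _ (by simp)).of_eq (by simp [logMax, maxValLen]) (by simp [scanCost])
  | e :: E, ρ, F, T, hs1, hs2, m2, B, β, hE, hB => by
    obtain ⟨hk, hv⟩ := hE e (by simp)
    have hE' : BoundedLog β E := fun f hf => hE f (by simp [hf])
    have hmax : itemMax (itemMax B e.1.length false) e.2.length true ≤ β := by
      simp only [itemMax, Bool.cond_true, Bool.cond_false]; exact max_le hB hv
    -- after the two items of `e`: the rest of the log
    have hrest := scanR_log E ρ F T hs1 hs2 (true :: false :: ((tagged e.2.reverse).reverse ++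
      (false :: false :: ((tagged e.1.reverse.reverse).reverse ++ m2)))) (itemMax (itemMax B e.1.length false) e.2.length true) β hE' hmax
    -- the value item
    have hval := scanR_item_cont ρ F T hs1 hs2 e.2.reverse (encLog E) (false :: false :: ((tagged e.1.reverse.reverse).reverse ++ m2))
      true (itemMax B e.1.length false) (by simpa using hrest)
    -- the key item
    have hkey := scanR_item_cont ρ F T hs1 hs2 e.1.reverse.reverse (tagged e.2.reverse ++ false :: true :: encLog E) m2 false B
      (by simpa using hval)
    have e1 : stateQ (scSt ρ (tagged e.1.reverse.reverse ++ false :: false :: (tagged e.2.reverse ++ false :: true :: encLog E)) m2) F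
        { T with w1 := [], w2 := [], s3 := [], lc := ones B, c2 := [] } =
        stateQ (scSt ρ (encLog (e :: E)) m2) F { T with w1 := [], w2 := [], s3 := [], lc := ones B, c2 := [] } := by
      simp [encLog_cons, encItem_eq_tagged, List.append_assoc]
    refine ((hkey.start_eq e1).of_eq ?_ ?_)
    · simp [encLog_cons, encItem_eq_tagged, List.append_assoc, logMax, maxValLen, itemMax, max_assoc]
    · simp only [List.length_reverse, scanCost, List.length_cons, itemMax, Bool.cond_false]
      have : max B e.1.length ≤ β := max_le hB hk
      have h14 : 14 * max B e.1.length ≤ 14 * β := Nat.mul_le_mul_left 14 this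
      nlinarith [hk, hv, hB, h14]

/-- `rulerScan k`: scan the log for the longest value numeral `m`, restore the log, make `lc` at
least one, put `k` copies of it on the (empty) ruler `wr`, clear `lc`. [folklore] -/
def repLc : ℕ → Com RQ
  | 0 => skip
  | k + 1 => copy (rX .lc) (rK .wr) (rX .s1) (rX .s2) ;; repLc k

/-- The scan followed by the ruler: `wr := 1^{k · max 1 m}`. [folklore] -/
def rulerScan (k : ℕ) : Com RQ :=
  (((scanLoopR ;; pour (rK .mem2) (rK .mem)) ;; pop (rX .lc) (push (rX .lc) true) (push (rX .lc) true) (push (rX .lc) true)) ;;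
    repLc k) ;; clear (rX .lc)

/-- Effect of `repLc`: `k` copies of `lc` onto `wr`. [folklore] -/
theorem runs_repLc (ρ : St) (F : Regs AReg) (T : XS) (hs1 : T.s1 = []) (hs2 : T.s2 = []) (m : ℕ) :
    ∀ (k : ℕ) (r : ℕ), Runs (repLc k) (stateQ { ρ with wr := ones r } F { T with lc := ones m })
      (stateQ { ρ with wr := ones (k * m + r) } F { T with lc := ones m }) (k * (10 * m + 3))
  | 0, r => (Runs.skip _).of_eq (by simp) (by simp)
  | k + 1, r => by
    have h1 := runs_copy (a := rX .lc) (b := rK .wr) (t := rX .s1) (u := rX .s2) (by simp) (by simp) (by simp) (by simp) (by simp)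
      (by simp) (stateQ { ρ with wr := ones r } F { T with lc := ones m }) (by simp [hs1]) (by simp [hs2])
    simp only [stateQ_rX, XS.regs_lc, stateQ_rK, St.regs_wr, ones_append, List.length_replicate, update_stateQ_rK,
      update_state_inl, St.update_regs_wr] at h1
    have h2 := runs_repLc ρ F T hs1 hs2 m k (m + r)
    refine (h1.seq h2).of_eq ?_ ?_
    · rw [show k * m + (m + r) = (k + 1) * m + r by ring]
    · simp only [ones] at *
      ring_nf; omega

/-- The cost of `rulerScan` on a log of `n` entries with numerals of at most `β` digits. [folklore] -/
def rulerCost (β n k : ℕ) : ℕ := scanCost β n + (3 * ((4 * β + 4) * n) + 1) + 3 + k * (10 * (β + 1) + 3) + (2 * (β + 1) + 1)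

/-- **The ruler.** From a clean file holding the `β`-bounded log `E` and an empty ruler, with the
scan registers of the extra file empty: the log is restored and `wr := 1^{k · max 1 (maxValLen E)}`.
[folklore] -/
theorem runs_rulerScan (ρ : St) (F : Regs AReg) (T : XS) (hs1 : T.s1 = []) (hs2 : T.s2 = []) {E : List (List Bool × List Bool)}
    {β : ℕ} (hE : BoundedLog β E) (hmem : ρ.mem = encLog E) (hmem2 : ρ.mem2 = []) (hwr : ρ.wr = []) (k : ℕ) :
    Runs (rulerScan k) (stateQ ρ F { T with w1 := [], w2 := [], s3 := [], lc := [], c2 := [] })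
      (stateQ { ρ with wr := ones (k * max 1 (maxValLen E)) } F { T with w1 := [], w2 := [], s3 := [], lc := [], c2 := [] })
      (rulerCost β E.length k) := by
  unfold rulerScan rulerCost
  have e0 : stateQ ρ F { T with w1 := [], w2 := [], s3 := [], lc := [], c2 := [] } =
      stateQ (scSt ρ (encLog E) []) F { T with w1 := [], w2 := [], s3 := [], lc := ones 0, c2 := [] } := by
    have : scSt ρ (encLog E) [] = ρ := by cases ρ; simp only at hmem hmem2; simp [scSt, hmem, hmem2]
    rw [this]; rfl
  have h1 := (scanR_log E ρ F T hs1 hs2 [] 0 β hE (Nat.zero_le _)).start_eq e0.symm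
  simp only [List.append_nil, logMax, Nat.zero_max] at h1
  have h2 := h1.seq (runs_pour (a := rK .mem2) (b := rK .mem) (by simp) _)
  simp only [stateQ_rK, St.regs_mem2, St.regs_mem, List.reverse_reverse, List.append_nil, List.length_reverse,
    update_stateQ_rK, update_state_inl, St.update_regs_mem2, St.update_regs_mem] at h2
  -- `lc := max 1 lc`
  set m := maxValLen E with hm
  have h3 : Runs (pop (rX .lc) (push (rX .lc) true) (push (rX .lc) true) (push (rX .lc) true))
      (stateQ (scSt ρ (encLog E) []) F { T with w1 := [], w2 := [], s3 := [], lc := ones m, c2 := [] })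
      (stateQ (scSt ρ (encLog E) []) F { T with w1 := [], w2 := [], s3 := [], lc := ones (max 1 m), c2 := [] }) 3 := by
    rcases m with _ | m'
    · exact (Runs.pop_nil _ _ (by simp) (Runs.push' (by simp [ones]))).of_eq rfl (by omega)
    · have hk : stateQ (scSt ρ (encLog E) []) F { T with w1 := [], w2 := [], s3 := [], lc := ones (m' + 1), c2 := [] } (rX .lc) = true :: ones m' := by
        simp [ones_succ]
      have hupd : Function.update (stateQ (scSt ρ (encLog E) []) F { T with w1 := [], w2 := [], s3 := [], lc := ones (m' + 1), c2 := [] }) (rX .lc) (ones m') =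
          stateQ (scSt ρ (encLog E) []) F { T with w1 := [], w2 := [], s3 := [], lc := ones m', c2 := [] } := by simp
      have hmx : max 1 (m' + 1) = m' + 1 := by omega
      rw [hmx]
      exact (Runs.pop_true' _ _ hk hupd (Runs.push' (by simp [ones_succ]))).of_eq rfl (by omega)
  have h4 := (h2.seq h3).seq ((runs_repLc (scSt ρ (encLog E) []) F { T with w1 := [], w2 := [], s3 := [], c2 := [] } hs1 hs2 (max 1 m) k 0).start_eq
    (by have : (scSt ρ (encLog E) []).wr = [] := hwr; simp [← this]))
  simp only [Nat.add_zero] at h4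
  have h5 := h4.seq (runs_clear (rX .lc) _)
  simp only [stateQ_rX, XS.regs_lc, List.length_replicate, update_stateQ_rX, XS.update_regs_lc] at h5
  refine h5.of_eq ?_ ?_
  · simp [hmem, hmem2]
  · have hL := length_encLog_le hE
    have hm1 : max 1 m ≤ β + 1 := by
      rcases maxValLen_eq_zero_or_mem E with h0 | ⟨e, he, hl⟩
      · rw [← hm] at h0; omega
      · have := (hE e he).2; rw [hl] at this; omega
    have := Nat.mul_le_mul_left k (show 10 * max 1 m + 3 ≤ 10 * (β + 1) + 3 by omega)
    simp only [ones] at *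
    nlinarith [hL, hm1, this]

/-! ### The master counter of the rebuild -/

/-- `boundU c`: `un := 1^{2^W + c}` from the ruler `wr = 1^W` (copied as a counter, `W` doublings of
`un = [1]`, then `c` more units). [folklore] -/
def boundU (c : ℕ) : Com RQ :=
  ((push (rX .un) true ;; copy (rK .wr) (rX .cnt) (rX .s1) (rX .s2)) ;; loop (rX .cnt) (dblReg (rX .un) (rX .s1)) (dblReg (rX .un) (rX .s1))) ;;
    pushK (rX .un) c

/-- The doubling loop: `un := 1^{2^r · u}`. [folklore] -/
theorem runs_dblLoop (ρ : St) (F : Regs AReg) (T : XS) (hs1 : T.s1 = []) :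
    ∀ (r u : ℕ), Runs (loop (rX .cnt) (dblReg (rX .un) (rX .s1)) (dblReg (rX .un) (rX .s1)))
      (stateQ ρ F { T with un := ones u, cnt := ones r }) (stateQ ρ F { T with un := ones (2 ^ r * u), cnt := [] })
      (r * (10 * (2 ^ r * u) + 4) + 1)
  | 0, u => (Runs.loop_nil _ _ (by simp)).of_eq (by simp) (by simp)
  | r + 1, u => by
    have hk : stateQ ρ F { T with un := ones u, cnt := ones (r + 1) } (rX .cnt) = true :: ones r := by simp [ones_succ]
    have hd := runs_dblReg (p := rX .un) (t := rX .s1) (by simp) (stateQ ρ F { T with un := ones u, cnt := ones r }) (by simp [hs1])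
    simp only [stateQ_rX, XS.regs_un, List.length_replicate, ones, update_stateQ_rX, XS.update_regs_un] at hd
    have ih := runs_dblLoop ρ F T hs1 r (2 * u)
    have hupd : Function.update (stateQ ρ F { T with un := ones u, cnt := ones (r + 1) }) (rX .cnt) (ones r) =
        stateQ ρ F { T with un := ones u, cnt := ones r } := by simp
    refine (Runs.loop_true' hk hupd (by simpa [ones] using hd) ih).of_eq ?_ ?_
    · rw [show 2 ^ r * (2 * u) = 2 ^ (r + 1) * u by ring]
    · have : 2 ^ r * (2 * u) = 2 ^ (r + 1) * u := by ring
      rw [this]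
      have hu : u ≤ 2 ^ (r + 1) * u := Nat.le_mul_of_pos_left u (by positivity)
      have hmono : r * (10 * (2 ^ (r + 1) * u) + 4) ≤ (r + 1) * (10 * (2 ^ (r + 1) * u) + 4) := Nat.mul_le_mul_right _ (by omega)
      nlinarith [hu, hmono]

/-- **Effect of `boundU`**: `un := 1^{2^W + c}` (`un`, `cnt` empty before; `wr = 1^W` kept). [folklore] -/
theorem runs_boundU (ρ : St) (F : Regs AReg) (T : XS) (hs1 : T.s1 = []) (hs2 : T.s2 = []) {W : ℕ} (hwr : ρ.wr = ones W) (c : ℕ)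
    (hun : T.un = []) (hcnt : T.cnt = []) :
    Runs (boundU c) (stateQ ρ F T) (stateQ ρ F { T with un := ones (2 ^ W + c) }) (1 + (10 * W + 3) + (W * (10 * 2 ^ W + 4) + 1) + c) := by
  unfold boundU
  have p1 : Runs (push (rX .un) true) (stateQ ρ F T) (stateQ ρ F { T with un := ones 1 }) 1 := Runs.push' (by simp [hun, ones])
  have h2 := p1.seq (runs_copy (a := rK .wr) (b := rX .cnt) (t := rX .s1) (u := rX .s2) (by simp) (by simp) (by simp) (by simp) (by simp)
    (by simp) _ (by simp [hs1]) (by simp [hs2]))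
  simp only [stateQ_rK, St.regs_wr, hwr, stateQ_rX, XS.regs_cnt, hcnt, List.append_nil, List.length_replicate, update_stateQ_rX,
    XS.update_regs_cnt] at h2
  have h3 := h2.seq (runs_dblLoop ρ F { T with un := ones 1 } hs1 W 1)
  simp only [Nat.mul_one] at h3
  have h4 := h3.seq (runs_pushK (rX .un) c _)
  simp only [stateQ_rX, XS.regs_un, ones_append, update_stateQ_rX, XS.update_regs_un] at h4
  refine h4.of_eq ?_ ?_
  · rw [Nat.add_comm c]
    cases T; simp only at hcnt; simp [hcnt]
  · simp only [ones] at *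
    omega

end Literature.Computability.Cryptography.WordRAM.ToTM2
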